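import Summits.BirchSwinnertonDyer.Uniform.U2.TwistTwoTorsionField
import Summits.BirchSwinnertonDyer.Uniform.U2.LocalTwoTorsionOddIndex
import Summits.BirchSwinnertonDyer.Rank1Residual.X2.TwistTamagawa
import Literature.NumberTheory.EllipticCurves.MatsunoTwistedCurvesLocalProofs
import Literature.NumberTheory.EllipticCurves.KramerDescentLocalGeneratorsProofs
import Literature.NumberTheory.EllipticCurves.CyclotomicIwasawaMainTheoremIrreducibleBaseChangeProofs
import Literature.NumberTheory.EllipticCurves.VariableChangePointsMap
import HarnessLib

/-!
# Track U2 (cell `bsd-uniform`, seat u2-p1): the `2`-adic Tamagawa balance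
# `ord₂ ∏ c(E^{(d)}) = ord₂ ∏ c(E)` as a CLASS THEOREM on the a_q-odd family with all odd bad
# primes split in `ℚ(√d)` (the per-twist-pair binder `hc`, HOME/RESIDUE.md R-A7 / T4-PROOF L3)

HONEST FRAMING (cell `bsd-uniform`, HOME run/shared/lean/pub/bsd-uniform/): a theorem on local
Tamagawa numbers of quadratic twists; no claim about BSD beyond it; nothing booked, no census number
moved. The end-to-end heads `bsdp_two_of_genusTheory_*` carry the PER-TWIST-PAIR binder
`hc : ord₂(c(W₂)·c(W₁)) = ord₂(c(W₀)·c(W))` — until now CERTIFICATE-DERIVED pair by pair (referee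
V17 C2-F1). This file proves the per-curve identity `ord₂ ∏_ℓ c_ℓ(E^{(d)}) = ord₂ ∏_ℓ c_ℓ(E)`
UNIFORMLY on the sub-family: `W` globally minimal, `d ≡ 1 (mod 8)`, every prime `q ∣ d` good for
`E` with `a_q(E)` odd (the cell's class condition `hS`), and EVERY ODD PRIME OF THE CONDUCTOR SPLIT
in `ℚ(√d)` (`(d/p) = 1`; stronger than Mazur–Rubin's Prop. 3.3 binders, which only ask this of the
additive and even-`ord` multiplicative primes — the odd-`ord` multiplicative primes inert in `ℚ(√d)`
are EXCLUDED here: there `c_p(E), c_p(E^{(d)}) ∈ {n, 1 or 2}` would need Tate's value `c = 1` for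
non-split `I_n`, `n` odd, which the tree does not carry).

Prime by prime (`padicValNat_two_localTamagawaNumber_twist_eq`):
* `ℓ ∣ N`: `d ∈ (ℚ_ℓ^×)²` — `ℓ = 2`: `d ≡ 1 (mod 8)` (tree `KramerLocal.padicTwo_isSquare_intCast`);
  `ℓ` odd: `(d/ℓ) = 1` + Hensel (tree `padic_isSquare_of_jacobiSym_eq_one`) —, so `E^{(d)} ⊗ ℚ_ℓ`
  is a change of variables of `E ⊗ ℚ_ℓ` (`exists_variableChange_smul_eq_quadraticTwist_sq`,
  `map_quadraticTwist`, `baseChange_smul_eq`) and `c_ℓ` is an isomorphism invariant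
  (`localTamagawaNumber_variableChange_holds`);
* `ℓ ∤ N d`: both curves good at `ℓ`, `c_ℓ = 1` (`localTamagawaNumber_eq_one_of_hasGoodReduction_holds`,
  `X2.localTamagawaNumber_twist_of_not_dvd`);
* `ℓ = q ∣ d`: `c_q(E) = 1`, and `c_q(E^{(d)})` is ODD: `a_q` odd gives `E(ℚ_q)[2] = 0`
  (`TransportAOddTrace.forall_two_nsmul_eq_zero_iff_odd_frobeniusTrace`), hence `E^{(d)}(ℚ_q)[2] = 0`
  for a globally minimal model of the twist (`TwoTorsionField.forall_two_nsmul_eq_zero_iff_of_twist`,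
  `exists_isGloballyMinimal_smul_eq_quadraticTwist`), hence `c_q` odd by
  `LocalTwoTorsionOddIndex.forall_two_nsmul_eq_zero_iff_odd_tamagawa_and_odd_frobeniusTrace`
  (Mazur–Rubin Lemma 2.10 (ii) mechanism; type `I₀*` with no rational `2`-division root).
Assembled over the union of the bad places (`tamagawaProduct_eq_prod`, as in
`X2/TwistTamagawa.lean`): `padicValNat_two_tamagawaProduct_twist_eq`.

References: Silverman AEC VII.6, X.5 Cor. 5.4 [SilvermanAEC2009]; Mazur–Rubin 2010 Lemma 2.10
[MazurRubin2010]; Jetchev–Skinner–Wan 2017 §7.4.1 (the prime-by-prime shape) [JetchevSkinnerWan2017];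
T4-PROOF.md v1.9b §3 L3 (HOME).
-/

set_option autoImplicit false

noncomputable section

open scoped Classical

open IsDedekindDomain NumberField Rat.HeightOneSpectrum WeierstrassCurve
  Literature.NumberTheory.EllipticCurves

namespace Summit.BirchSwinnertonDyer.Uniform.U2

/-! ## §1 Prime by prime: `ord₂ c_ℓ(E^{(d)}) = ord₂ c_ℓ(E)` -/

/-- **`ord₂ c_ℓ(E^{(d)}) = ord₂ c_ℓ(E)` at every prime `ℓ`, for the a_q-odd class with all odd bad
primes split in `ℚ(√d)`.** `W/ℚ` globally minimal elliptic of conductor `N`, `d ≡ 1 (mod 8)` with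
`E` good and `a_q` odd at every prime `q ∣ d`, `(d/p) = 1` at every odd `p ∣ N`; `W₁` ANY model of
`E^{(d)}`. Cases: `ℓ ∣ N` — `d ∈ (ℚ_ℓ^×)²` (`ℓ = 2`: `d ≡ 1 (mod 8)`; `ℓ` odd: Hensel), the curves
are `ℚ_ℓ`-isomorphic, `c_ℓ` equal; `ℓ ∤ N d` — both good at `ℓ`, `c_ℓ = 1`; `ℓ = q ∣ d` —
`c_q(E) = 1` and `c_q(E^{(d)})` is ODD: `E(ℚ_q)[2] = 0` (`a_q` odd), hence `E^{(d)}(ℚ_q)[2] = 0`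
(`TwoTorsionField.forall_two_nsmul_eq_zero_iff_of_twist`), hence `c_q` odd by
`forall_two_nsmul_eq_zero_iff_odd_tamagawa_and_odd_frobeniusTrace` on a globally minimal model.
[cite: SilvermanAEC2009, VII.6 and X.5 Cor. 5.4] [cite: MazurRubin2010, Lemma 2.10 (ii)] -/
theorem padicValNat_two_localTamagawaNumber_twist_eq (W : WeierstrassCurve ℚ) [W.IsElliptic]
    [W.IsGloballyMinimal] {d : ℤ} (hd8 : d % 8 = 1)
    (hS : ∀ (q : ℕ), q.Prime → (q : ℤ) ∣ d →
      ¬ (q : ℤ) ∣ minimalDiscriminantInt W ∧ Odd (W.frobeniusTrace q))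
    (hsplit : ∀ (p : ℕ), p.Prime → p ∣ W.conductorNorm ℤ → p ≠ 2 → jacobiSym d p = 1)
    {W₁ : WeierstrassCurve ℚ} [W₁.IsElliptic]
    (h₁ : ∃ C : VariableChange ℚ, C • W₁ = W.quadraticTwist (d : ℚ)) (ℓ : ℕ) [Fact ℓ.Prime] :
    padicValNat 2 ((W₁.baseChange ℚ_[ℓ]).localTamagawaNumber ℤ_[ℓ]) =
      padicValNat 2 ((W.baseChange ℚ_[ℓ]).localTamagawaNumber ℤ_[ℓ]) := by
  have hℓP : ℓ.Prime := Fact.out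
  have hd0 : d ≠ 0 := by rintro rfl; norm_num at hd8
  have hdQ : (d : ℚ) ≠ 0 := by exact_mod_cast hd0
  obtain ⟨C, hC⟩ := h₁
  have hWd : C⁻¹ • W.quadraticTwist (d : ℚ) = W₁ := by rw [← hC, inv_smul_smul]
  haveI : (W.baseChange ℚ_[ℓ]).IsElliptic := inferInstanceAs (W.map (algebraMap ℚ ℚ_[ℓ])).IsElliptic
  haveI : (W₁.baseChange ℚ_[ℓ]).IsElliptic := inferInstanceAs (W₁.map (algebraMap ℚ ℚ_[ℓ])).IsElliptic
  haveI : (W.quadraticTwist (d : ℚ)).IsElliptic := W.isElliptic_quadraticTwist hdQ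
  by_cases hℓN : ℓ ∣ W.conductorNorm ℤ
  · -- `ℓ ∣ N`: `d` is a square in `ℚ_ℓ`, the two curves are `ℚ_ℓ`-isomorphic
    have hsq : IsSquare ((d : ℤ) : ℚ_[ℓ]) := by
      by_cases hℓ2 : ℓ = 2
      · subst hℓ2
        exact KramerLocal.padicTwo_isSquare_intCast (by omega)
      · exact padic_isSquare_of_jacobiSym_eq_one hℓ2 (hsplit ℓ hℓP hℓN hℓ2)
    obtain ⟨θ, hθ⟩ := hsq
    have hθ0 : θ ≠ 0 := by
      rintro rfl
      rw [mul_zero] at hθ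
      exact hd0 (by exact_mod_cast hθ)
    obtain ⟨C', hC'⟩ := (W.baseChange ℚ_[ℓ]).exists_variableChange_smul_eq_quadraticTwist_sq hθ0
    have h1 : (W.quadraticTwist (d : ℚ)).baseChange ℚ_[ℓ] = C' • W.baseChange ℚ_[ℓ] := by
      rw [hC', WeierstrassCurve.baseChange, WeierstrassCurve.baseChange, map_quadraticTwist, sq,
        map_intCast, hθ]
    have hYX : W₁.baseChange ℚ_[ℓ] = (C⁻¹.map (algebraMap ℚ ℚ_[ℓ]) * C') • W.baseChange ℚ_[ℓ] := by
      rw [← hWd, WeierstrassCurve.VariableChange.baseChange_smul_eq (W.quadraticTwist (d : ℚ)) C⁻¹ ℚ_[ℓ],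
        h1, mul_smul]
    rw [hYX, localTamagawaNumber_variableChange_holds ℤ_[ℓ] (W.baseChange ℚ_[ℓ])
      (C⁻¹.map (algebraMap ℚ ℚ_[ℓ]) * C')]
  · -- `ℓ ∤ N`: `W` is good at `ℓ`, `c_ℓ(W) = 1`
    have hgood : W.HasGoodReductionAtPrime ℓ := by
      by_contra h
      exact hℓN ((W.dvd_conductorNorm_iff_not_hasGoodReductionAtPrime ℓ).mpr h)
    have hcW : (W.baseChange ℚ_[ℓ]).localTamagawaNumber ℤ_[ℓ] = 1 := by
      haveI : ((W.baseChange ℚ_[ℓ]).minimal ℤ_[ℓ]).HasGoodReduction ℤ_[ℓ] := hgood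
      exact localTamagawaNumber_eq_one_of_hasGoodReduction_holds ℤ_[ℓ] _
    rw [hcW, padicValNat_one_right]
    by_cases hℓd : (ℓ : ℤ) ∣ d
    · -- `ℓ = q ∣ d`: `E(ℚ_q)[2] = 0` (a_q odd) ⇒ `E^{(d)}(ℚ_q)[2] = 0` ⇒ `c_q(E^{(d)})` odd
      have hℓ2 : ℓ ≠ 2 := by rintro rfl; have : (2 : ℤ) ∣ d := hℓd; omega
      obtain ⟨hℓΔ, hodd⟩ := hS ℓ hℓP hℓd
      have hE : ∀ Q : (W.baseChange ℚ_[ℓ]).toAffine.Point, 2 • Q = 0 → Q = 0 :=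
        (forall_two_nsmul_eq_zero_iff_odd_frobeniusTrace W hℓ2 hℓΔ).mpr hodd
      -- a globally minimal model of the twist
      obtain ⟨W₁', hW₁'e, hW₁'m, C₁, hC₁⟩ := exists_isGloballyMinimal_smul_eq_quadraticTwist W hdQ
      haveI := hW₁'e
      haveI := hW₁'m
      have hE' : ∀ Q : (W₁'.baseChange ℚ_[ℓ]).toAffine.Point, 2 • Q = 0 → Q = 0 :=
        (TwoTorsionField.forall_two_nsmul_eq_zero_iff_of_twist W hdQ W₁' ⟨C₁, hC₁⟩).mp hE
      have hc₁odd := ((forall_two_nsmul_eq_zero_iff_odd_tamagawa_and_odd_frobeniusTrace W₁' ℓ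
        hℓ2).mp hE').1
      -- `W₁ ≅ W₁'` over `ℚ`, so `c_ℓ(W₁) = c_ℓ(W₁')`
      haveI : (W₁'.baseChange ℚ_[ℓ]).IsElliptic :=
        inferInstanceAs (W₁'.map (algebraMap ℚ ℚ_[ℓ])).IsElliptic
      have hW₁W₁' : W₁ = (C⁻¹ * C₁) • W₁' := by rw [mul_smul, hC₁, hWd]
      have hloc : (W₁.baseChange ℚ_[ℓ]).localTamagawaNumber ℤ_[ℓ] =
          (W₁'.baseChange ℚ_[ℓ]).localTamagawaNumber ℤ_[ℓ] := by
        rw [hW₁W₁', WeierstrassCurve.VariableChange.baseChange_smul_eq W₁' (C⁻¹ * C₁) ℚ_[ℓ],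
          localTamagawaNumber_variableChange_holds ℤ_[ℓ] (W₁'.baseChange ℚ_[ℓ])]
      rw [hloc]
      exact padicValNat.eq_zero_of_not_dvd (Nat.two_dvd_ne_zero.mpr (Nat.odd_iff.mp hc₁odd))
    · -- `ℓ ∤ N d`: unramified twist, good reduction preserved, `c_ℓ(E^{(d)}) = 1`
      have h4 : d = 4 * (d / 4) + 1 := by omega
      rw [Rank1Residual.X2.localTamagawaNumber_twist_of_not_dvd W ℓ h4 hℓd hgood C⁻¹ hWd,
        padicValNat_one_right]

/-! ## §2 The `2`-adic Tamagawa balance -/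

/-- `ord_p` of a finite product of non-zero naturals is the sum of the `ord_p`. [folklore] -/
private theorem padicValNat_finset_prod'' (p : ℕ) [Fact p.Prime] {ι : Type*} (s : Finset ι)
    (f : ι → ℕ) (hf : ∀ i ∈ s, f i ≠ 0) :
    padicValNat p (∏ i ∈ s, f i) = ∑ i ∈ s, padicValNat p (f i) := by
  induction s using Finset.induction_on with
  | empty => simp
  | insert a s ha ih =>
    rw [Finset.prod_insert ha, Finset.sum_insert ha,
      padicValNat.mul (hf a (Finset.mem_insert_self a s))
        (Finset.prod_ne_zero_iff.mpr fun i hi => hf i (Finset.mem_insert_of_mem hi)),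
      ih fun i hi => hf i (Finset.mem_insert_of_mem hi)]

/-- **`ord₂ ∏_ℓ c_ℓ(E^{(d)}) = ord₂ ∏_ℓ c_ℓ(E)`** for the a_q-odd class with all odd bad primes
split in `ℚ(√d)` (`d ≡ 1 (mod 8)`), ANY model `W₁` of `E^{(d)}`: the per-twist-pair binder `hc`
("`2`-adic Tamagawa balance", HOME/RESIDUE.md R-A7) of the end-to-end heads as a CLASS THEOREM on
this sub-family. [cite: SilvermanAEC2009, VII.6 and X.5 Cor. 5.4] -/
theorem padicValNat_two_tamagawaProduct_twist_eq (W : WeierstrassCurve ℚ) [W.IsElliptic]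
    [W.IsGloballyMinimal] {d : ℤ} (hd8 : d % 8 = 1)
    (hS : ∀ (q : ℕ), q.Prime → (q : ℤ) ∣ d →
      ¬ (q : ℤ) ∣ minimalDiscriminantInt W ∧ Odd (W.frobeniusTrace q))
    (hsplit : ∀ (p : ℕ), p.Prime → p ∣ W.conductorNorm ℤ → p ≠ 2 → jacobiSym d p = 1)
    {W₁ : WeierstrassCurve ℚ} [W₁.IsElliptic]
    (h₁ : ∃ C : VariableChange ℚ, C • W₁ = W.quadraticTwist (d : ℚ)) :
    padicValNat 2 W₁.tamagawaProduct = padicValNat 2 W.tamagawaProduct := by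
  haveI : Fact (Nat.Prime 2) := ⟨Nat.prime_two⟩
  have hfW : (W.badPlaces ℤ).Finite := W.finite_badPlaces_holds ℤ
  have hfW₁ : (W₁.badPlaces ℤ).Finite := W₁.finite_badPlaces_holds ℤ
  set s : Finset (HeightOneSpectrum ℤ) := hfW.toFinset ∪ hfW₁.toFinset with hs
  have hsW : ∀ v, ¬ W.HasGoodReductionAt v → v ∈ s := fun v hv ↦
    Finset.mem_union_left _ (by rw [Set.Finite.mem_toFinset, mem_badPlaces_iff]; exact hv)
  have hsW₁ : ∀ v, ¬ W₁.HasGoodReductionAt v → v ∈ s := fun v hv ↦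
    Finset.mem_union_right _ (by rw [Set.Finite.mem_toFinset, mem_badPlaces_iff]; exact hv)
  rw [tamagawaProduct_eq_prod W s hsW, tamagawaProduct_eq_prod W₁ s hsW₁,
    padicValNat_finset_prod'' 2 s _ fun v _ ↦ ?_, padicValNat_finset_prod'' 2 s _ fun v _ ↦ ?_]
  · refine Finset.sum_congr rfl fun v _ ↦ ?_
    haveI := Fact.mk (primesEquiv v).2
    exact padicValNat_two_localTamagawaNumber_twist_eq W hd8 hS hsplit h₁ (primesEquiv v)
  · haveI := Fact.mk (primesEquiv v).2
    haveI : (W₁.baseChange ℚ_[primesEquiv v]).IsElliptic :=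
      inferInstanceAs (W₁.map (algebraMap ℚ ℚ_[primesEquiv v])).IsElliptic
    exact localTamagawaNumber_padic_ne_zero_holds (primesEquiv v) _
  · haveI := Fact.mk (primesEquiv v).2
    haveI : (W.baseChange ℚ_[primesEquiv v]).IsElliptic :=
      inferInstanceAs (W.map (algebraMap ℚ ℚ_[primesEquiv v])).IsElliptic
    exact localTamagawaNumber_padic_ne_zero_holds (primesEquiv v) _

end Summit.BirchSwinnertonDyer.Uniform.U2

end
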